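/-
Copyright: the b2b-balaban T⁴-continuum CRUX team, row NE7b OWNER lineage `t4-ne7b-p1` (gen 128). Project licence.
-/
import Summits.QuantumFields.BalabanUV.T4Continuum.Spine.NE7b.SupRegulatedActivityBound
import Summits.QuantumFields.BalabanUV.T4Continuum.Spine.NE7b.SupFibreScaleSmallField
import Summits.QuantumFields.BalabanUV.T4Continuum.Spine.NE7b.SupFibreScaleReference

/-!
# EVERY SCALE OF THE FLUCTUATION MEASURE IS A CONVERGENT POLYMER-GAS REFERENCE FOR REGULATED FACTORS: for (273)'s data (`H` symmetric
# with floor `m` and ceiling `Λ_H`, chart `P` with bound `p` and ceiling `q`, `M_z(j,k) = H(Pe_j)(Pe_k)`, `c = 4∕(Λ_Hq)`) the scale-`N` chart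
# covariance `Γ_N = c·C_N(cM_z)` of (280) obeys `0 ⪯ Γ_N ⪯ K_N·1` and `Γ_N(j,j) ≤ K_N`, `K_N = c·π⁴∕(4·4^N·(cmp)²) = O(4^{−N})`, so chart-cell
# factors regulated at strength `κ` with `κK_N ≤ θ < 1` have activities `≤ (εA_N^v)^{#K}`, `A_N = (1−θ)^{−κK_N∕(2θ)}`, and under
# `e·εA_N^v·(Δ+1)² ≤ 1∕2` the scale-`N` integral `∫∏_p(1+g_p) dN(0,Γ_N)` is a zero-free polymer gas with `‖log Z(C)‖ ≤ #C(Δ+1)2e·εA_N^v`,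
# uniformly in the volume — the regulator strength may grow like `4^N` along the scales (row NE7b, node U5c; (289) docked on (280)∕(284)∕(285)
# BY NAME; [folklore])

Cell `pub-balaban`, sub-cell `t4`, spine estimate NE7b (`T4WeightBudget.RelWeightBound`; the cell's OWN estimate — NOT PRINTED in
[Bałaban 1983–89], NOT PROVED).  Crux-route work under `Spine/NE7b/` by the row OWNER (`t4-ne7b-p1` gen 128, file (291)) under FREEZE
(0)'s crux-prover clause, on § [NE7bP1-G127-HANDOFF] NEXT (3)(b); NOTHING of Bałaban's is named as a Lean object, valued or asserted; no
`T4Continuum/Support` leaf typed; no `def`, no notation; zero `sorry`.  Imports (BY NAME): the OWNER's (289) `…SupRegulatedActivityBound`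
(`regulated_pertZ_eq_polymerPartitionFunction`, `regulated_pertZ_ne_zero`, `regulated_norm_pertZ_sdiff_div_le`, `regulated_norm_pertLogZ_le`),
(285) `…SupFibreScaleSmallField` (`scaled_floor_posSemidef`, `scale_diag_le`), (284) `…SupFrdPieceDecay` (`frdPiece_le`), (280)
`…SupFibreGaussianScaleSplit` (`scale_posSemidef`, `scale_hasFiniteRange`), (273) `…SupFibreFiniteRangeDecomposition` (`scaled_isHermitian`,
`four_sub_scaled_posSemidef`).

WHY (located).  (289) is stated for one abstract Gaussian reference `N(0,Γ)` with `Γ ⪯ γ_op·1`, diagonal `≤ γ`, range `ρ`; the road's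
references are the scale pieces `Γ_N = c·C_N(cM_z)` of (280)'s split of the fluctuation law, whose operator bound AND diagonal bound are the
single-shell constant `K_N` of (284) and whose chart range is `2(2^N−1)(2r+R_H)` by (280).  This file reads (289) on them: the only new
line is the Loewner form `Γ_N ⪯ K_N·1` of (284)'s `frdPiece_le` at the scaled precision matrix.

WHAT IS PROVED ([folklore]):
* §1 **`scale_opBound`** (`K_N·1 − Γ_N ⪰ 0`), `scale_const_nonneg` (`0 ≤ K_N`);
* §2 THE END for REGULATED chart-cell factors `‖g_p(ω)‖ ≤ ε·e^{½κΣ_{j∈cell p}ω_j²}` (disjoint chart cells of `≤ v` indices, `0 ≤ ε`, `0 ≤ κ`,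
  `0 < θ < 1`, `κK_N ≤ θ`) under the scale-`N` law `N(0, Γ_N)`: **`scale_regulated_norm_cellActivity_le`** (`‖M(K)‖ ≤ (εA_N^v)^{#K}`),
  **`scale_regulated_pertZ_eq_polymerPartitionFunction`** and **`scale_regulated_pertZ_ne_zero`** (for any adjacency `R` covering the scale-`N`
  chart closeness `dι(home j, home k) ≤ 2(2^N−1)(r+R_H+r)`, `≤ Δ` neighbours, `e·εA_N^v·(Δ+1)² ≤ 1∕2`), **`scale_regulated_norm_pertLogZ_le`**
  (`‖log Z(C)‖ ≤ #C(Δ+1)2e·εA_N^v` for any symmetric `R` with `≤ Δ` neighbours); §3 toy.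

HONEST (what this is NOT).  One scale at a time (the factors' dependence on the coarser fields and the renormalised regulator along (280)'s
convolution are not typed here); chart coordinates (the road's factors are functions of `Pz` — cell-measurable and regulated in `z` by (279)'s
block-locality and the chart ceiling, to be read by the consumer); scalar skeleton ((A3), NC-NE7b-α UNRULED); nothing of Bałaban's asserted.
BY-NAME EFFECT ON THE WALL: NONE.  NE7b NOT PRINTED ∕ NOT PROVED; spine PROVED 0∕9; rung (B)+1 — the programme's measures remain FINITE-torus
statements; NOT the mass gap, NOT Clay.  HONEST DEPENDENCY: continuum YM on T⁴ ⇐ BetaPertH ∧ nine spine estimates (0∕9 proved); BetaPertH ⇐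
(D1) ∧ (D4) ∧ CAP+tail; G-an2-4 gates asym, D1 and NE2∕3∕4.
-/

set_option autoImplicit false

noncomputable section

namespace Summit.QuantumFields.BalabanUV.T4Continuum.NE7b.SupFibreScaleRegulatedGas

open MeasureTheory ProbabilityTheory Matrix Real
open Literature.Analysis.Matrix (frdPiece)
open Literature.Probability.LatticeModels (Touches GeomInc IsRConnected pertZ cellActivity pertLogZ rconnSubsets
  polymerPartitionFunction)
open SupFibreFiniteRangeDecomposition (scaled_isHermitian four_sub_scaled_posSemidef)
open SupFibreGaussianScaleSplit (scale_posSemidef scale_hasFiniteRange)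
open SupFrdPieceDecay (frdPiece_le)
open SupFibreScaleSmallField (scaled_floor_posSemidef scale_diag_le)
open SupRegulatedActivityBound (norm_cellActivity_le_of_regulated regulated_pertZ_eq_polymerPartitionFunction regulated_pertZ_ne_zero
  regulated_norm_pertLogZ_le)

variable {ι : Type*} [Fintype ι] {σ : Type} [Fintype σ] [DecidableEq σ] {V : Type*}
  {H : (ι → ℝ) →L[ℝ] (ι → ℝ) →L[ℝ] ℝ} {m p ΛH q : ℝ} (P : (σ → ℝ) →L[ℝ] (ι → ℝ))
  {dι : ι → ι → ℕ} {home : σ → ι} {r RH : ℕ}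

/-! ## §1. The scale-`N` covariance is bounded by the single-shell constant `K_N` -/

/-- **`Γ_N ⪯ K_N·1`**: for (273)'s data, `K_N·1 − c·C_N(cM_z) ⪰ 0` with `c = 4∕(Λ_Hq)`, `K_N = c·π⁴∕(4·4^N·(cmp)²)` ((284)'s single-shell
Loewner bound at the scaled precision matrix, times `c`). [folklore] -/
theorem scale_opBound (hHsym : ∀ h k : ι → ℝ, H h k = H k h) (hfl : ∀ h : ι → ℝ, m * ∑ x, h x ^ 2 ≤ H h h) (hm : 0 < m)
    (hceil : ∀ h : ι → ℝ, H h h ≤ ΛH * ∑ x, h x ^ 2) (hΛH : 0 < ΛH) (hP : ∀ z : σ → ℝ, p * ∑ i, z i ^ 2 ≤ ∑ x, P z x ^ 2)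
    (hp : 0 < p) (hPceil : ∀ z : σ → ℝ, ∑ x, P z x ^ 2 ≤ q * ∑ i, z i ^ 2) (hq : 0 < q) (Mz : Matrix σ σ ℝ)
    (hMz : ∀ j k, Mz j k = H (P (Pi.single j 1)) (P (Pi.single k 1))) (N : ℕ) :
    (((4 / (ΛH * q)) * (π ^ 4 / (4 * 4 ^ N * ((4 / (ΛH * q)) * m * p) ^ 2))) • (1 : Matrix σ σ ℝ)
      - (4 / (ΛH * q)) • frdPiece ((4 / (ΛH * q)) • Mz) N).PosSemidef := by
  have hc : (0 : ℝ) < 4 / (ΛH * q) := by positivity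
  have hK := frdPiece_le ((4 / (ΛH * q)) • Mz) (scaled_isHermitian P hHsym Mz hMz _) (by positivity : 0 < (4 / (ΛH * q)) * m * p)
    (scaled_floor_posSemidef P hHsym hfl hm.le hP Mz hMz hc.le) (four_sub_scaled_posSemidef P hHsym hceil hΛH hPceil hq Mz hMz) N
  have h := hK.smul hc.le
  rwa [smul_sub, smul_smul] at h

/-- `0 ≤ K_N`. [folklore] -/
theorem scale_const_nonneg (hm : 0 < m) (hΛH : 0 < ΛH) (hp : 0 < p) (hq : 0 < q) (N : ℕ) :
    (0 : ℝ) ≤ (4 / (ΛH * q)) * (π ^ 4 / (4 * 4 ^ N * ((4 / (ΛH * q)) * m * p) ^ 2)) := by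
  positivity

/-! ## §2. THE END: regulated chart-cell factors at scale `N` -/

/-- **THE SCALE-`N` ACTIVITY BOUND**: for (273)'s data, disjoint chart cells of `≤ v` indices and regulated factors
`‖g_p(ω)‖ ≤ ε·e^{½κΣ_{j∈cell p}ω_j²}` (`0 ≤ ε`, `0 ≤ κ`, `0 < θ < 1`, `κK_N ≤ θ`): under `N(0, c·C_N(cM_z))`,
`‖∫∏_{p∈K} g_p‖ ≤ (ε·A_N^v)^{#K}`, `A_N = (1−θ)^{−κK_N∕(2θ)}`, for every finite `K`. [folklore] -/
theorem scale_regulated_norm_cellActivity_le [DecidableEq V] (hHsym : ∀ h k : ι → ℝ, H h k = H k h)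
    (hfl : ∀ h : ι → ℝ, m * ∑ x, h x ^ 2 ≤ H h h) (hm : 0 < m) (hceil : ∀ h : ι → ℝ, H h h ≤ ΛH * ∑ x, h x ^ 2) (hΛH : 0 < ΛH)
    (hP : ∀ z : σ → ℝ, p * ∑ i, z i ^ 2 ≤ ∑ x, P z x ^ 2) (hp : 0 < p) (hPceil : ∀ z : σ → ℝ, ∑ x, P z x ^ 2 ≤ q * ∑ i, z i ^ 2)
    (hq : 0 < q) (Mz : Matrix σ σ ℝ) (hMz : ∀ j k, Mz j k = H (P (Pi.single j 1)) (P (Pi.single k 1))) (N : ℕ)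
    (cell : V → Finset σ) (hdisj : ∀ p' q', p' ≠ q' → Disjoint (cell p') (cell q')) {v : ℕ} (hv : ∀ p', (cell p').card ≤ v)
    {g : V → EuclideanSpace ℝ σ → ℂ} {ε κ θ : ℝ} (hε : 0 ≤ ε) (hκ : 0 ≤ κ) (hθ0 : 0 < θ) (hθ1 : θ < 1)
    (hκθ : κ * ((4 / (ΛH * q)) * (π ^ 4 / (4 * 4 ^ N * ((4 / (ΛH * q)) * m * p) ^ 2))) ≤ θ)
    (hreg : ∀ p' ω, ‖g p' ω‖ ≤ ε * exp (κ * (∑ j ∈ cell p', ω j ^ 2) / 2)) (K : Finset V) :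
    ‖cellActivity (multivariateGaussian 0 ((4 / (ΛH * q)) • frdPiece ((4 / (ΛH * q)) • Mz) N)) g K‖ ≤
      (ε * ((1 - θ) ^ (-(κ * ((4 / (ΛH * q)) * (π ^ 4 / (4 * 4 ^ N * ((4 / (ΛH * q)) * m * p) ^ 2))) / (2 * θ)))) ^ v) ^ K.card :=
  norm_cellActivity_le_of_regulated (scale_posSemidef P hHsym Mz hMz (by positivity) N)
    (scale_opBound P hHsym hfl hm hceil hΛH hP hp hPceil hq Mz hMz N) (scale_diag_le P hHsym hfl hm hceil hΛH hP hp hPceil hq Mz hMz N)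
    (scale_const_nonneg hm hΛH hp hq N) cell hdisj hv hε hκ hθ0 hθ1 hκθ hreg K

/-- **THE SCALE-`N` POLYMER REPRESENTATION**: with an adjacency `R` covering the scale-`N` chart closeness (`dι(home j, home k) ≤
2(2^N−1)(r+R_H+r)` for `j ∈ cell p ≠ p' ∋ k` forces `R p p'`), `H` of range `R_H`, chart local with radius `r`, and cell-measurable regulated
factors: `Z(C) = Ξ(𝒫(C); M)` under `N(0, c·C_N(cM_z))`. [folklore] -/
theorem scale_regulated_pertZ_eq_polymerPartitionFunction [DecidableEq V] (hHsym : ∀ h k : ι → ℝ, H h k = H k h)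
    (hfl : ∀ h : ι → ℝ, m * ∑ x, h x ^ 2 ≤ H h h) (hm : 0 < m) (hceil : ∀ h : ι → ℝ, H h h ≤ ΛH * ∑ x, h x ^ 2) (hΛH : 0 < ΛH)
    (hP : ∀ z : σ → ℝ, p * ∑ i, z i ^ 2 ≤ ∑ x, P z x ^ 2) (hp : 0 < p) (hPceil : ∀ z : σ → ℝ, ∑ x, P z x ^ 2 ≤ q * ∑ i, z i ^ 2)
    (hq : 0 < q) (htri : ∀ x y w, dι x w ≤ dι x y + dι y w) (hsym : ∀ x y, dι x y = dι y x) (hd0 : ∀ x, dι x x = 0)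
    (hHloc : ∀ h k : ι → ℝ, (∀ x y, h x ≠ 0 → k y ≠ 0 → RH < dι x y) → H h k = 0)
    (hPloc : ∀ j x, r < dι (home j) x → P (Pi.single j 1) x = 0) (Mz : Matrix σ σ ℝ)
    (hMz : ∀ j k, Mz j k = H (P (Pi.single j 1)) (P (Pi.single k 1))) (N : ℕ)
    (cell : V → Finset σ) (hdisj : ∀ p' q', p' ≠ q' → Disjoint (cell p') (cell q')) {v : ℕ} (hv : ∀ p', (cell p').card ≤ v)
    {R : V → V → Prop} [DecidableRel R] (hRsymm : ∀ x y, R x y → R y x)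
    (hR : ∀ (p' p'' : V) (j k : σ), j ∈ cell p' → k ∈ cell p'' → dι (home j) (home k) ≤ 2 * (2 ^ N - 1) * (r + RH + r) →
      p' = p'' ∨ R p' p'')
    {g : V → EuclideanSpace ℝ σ → ℂ} {ε κ θ : ℝ} (hε : 0 ≤ ε) (hκ : 0 ≤ κ) (hθ0 : 0 < θ) (hθ1 : θ < 1)
    (hκθ : κ * ((4 / (ΛH * q)) * (π ^ 4 / (4 * 4 ^ N * ((4 / (ΛH * q)) * m * p) ^ 2))) ≤ θ)
    (hmeas : ∀ p', Measurable[MeasurableSpace.comap (fun (ω : EuclideanSpace ℝ σ) (x : cell p') => ω x) inferInstance] (g p'))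
    (hreg : ∀ p' ω, ‖g p' ω‖ ≤ ε * exp (κ * (∑ j ∈ cell p', ω j ^ 2) / 2)) (C : Finset V) :
    pertZ (multivariateGaussian 0 ((4 / (ΛH * q)) • frdPiece ((4 / (ΛH * q)) • Mz) N)) g C =
      polymerPartitionFunction (GeomInc R)
        (cellActivity (multivariateGaussian 0 ((4 / (ΛH * q)) • frdPiece ((4 / (ΛH * q)) • Mz) N)) g) (rconnSubsets R C) :=
  regulated_pertZ_eq_polymerPartitionFunction (scale_posSemidef P hHsym Mz hMz (by positivity) N)
    (scale_opBound P hHsym hfl hm hceil hΛH hP hp hPceil hq Mz hMz N) (scale_diag_le P hHsym hfl hm hceil hΛH hP hp hPceil hq Mz hMz N)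
    (scale_const_nonneg hm hΛH hp hq N) (scale_hasFiniteRange P htri hsym hd0 hHloc hPloc Mz hMz _ N) cell hdisj hv hRsymm hR hε hκ
    hθ0 hθ1 hκθ hmeas hreg C

/-- **ZERO-FREENESS AT SCALE `N`**: under the hypotheses of `scale_regulated_pertZ_eq_polymerPartitionFunction`, `≤ Δ` neighbours and
`e·εA_N^v·(Δ+1)² ≤ 1∕2`: `Z(C) ≠ 0` for every finite cell set `C`. [folklore] -/
theorem scale_regulated_pertZ_ne_zero [DecidableEq V] (hHsym : ∀ h k : ι → ℝ, H h k = H k h)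
    (hfl : ∀ h : ι → ℝ, m * ∑ x, h x ^ 2 ≤ H h h) (hm : 0 < m) (hceil : ∀ h : ι → ℝ, H h h ≤ ΛH * ∑ x, h x ^ 2) (hΛH : 0 < ΛH)
    (hP : ∀ z : σ → ℝ, p * ∑ i, z i ^ 2 ≤ ∑ x, P z x ^ 2) (hp : 0 < p) (hPceil : ∀ z : σ → ℝ, ∑ x, P z x ^ 2 ≤ q * ∑ i, z i ^ 2)
    (hq : 0 < q) (htri : ∀ x y w, dι x w ≤ dι x y + dι y w) (hsym : ∀ x y, dι x y = dι y x) (hd0 : ∀ x, dι x x = 0)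
    (hHloc : ∀ h k : ι → ℝ, (∀ x y, h x ≠ 0 → k y ≠ 0 → RH < dι x y) → H h k = 0)
    (hPloc : ∀ j x, r < dι (home j) x → P (Pi.single j 1) x = 0) (Mz : Matrix σ σ ℝ)
    (hMz : ∀ j k, Mz j k = H (P (Pi.single j 1)) (P (Pi.single k 1))) (N : ℕ)
    (cell : V → Finset σ) (hdisj : ∀ p' q', p' ≠ q' → Disjoint (cell p') (cell q')) {v : ℕ} (hv : ∀ p', (cell p').card ≤ v)
    {R : V → V → Prop} [DecidableRel R] (hRsymm : ∀ x y, R x y → R y x)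
    (hR : ∀ (p' p'' : V) (j k : σ), j ∈ cell p' → k ∈ cell p'' → dι (home j) (home k) ≤ 2 * (2 ^ N - 1) * (r + RH + r) →
      p' = p'' ∨ R p' p'') {nbr : V → Finset V} {Δ : ℕ} (hΔ : ∀ x, (nbr x).card ≤ Δ) (hnbr : ∀ x y, R x y → y ∈ nbr x)
    {g : V → EuclideanSpace ℝ σ → ℂ} {ε κ θ : ℝ} (hε : 0 ≤ ε) (hκ : 0 ≤ κ) (hθ0 : 0 < θ) (hθ1 : θ < 1)
    (hκθ : κ * ((4 / (ΛH * q)) * (π ^ 4 / (4 * 4 ^ N * ((4 / (ΛH * q)) * m * p) ^ 2))) ≤ θ)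
    (hmeas : ∀ p', Measurable[MeasurableSpace.comap (fun (ω : EuclideanSpace ℝ σ) (x : cell p') => ω x) inferInstance] (g p'))
    (hreg : ∀ p' ω, ‖g p' ω‖ ≤ ε * exp (κ * (∑ j ∈ cell p', ω j ^ 2) / 2))
    (hsmall : Real.exp 1 * (ε * ((1 - θ) ^ (-(κ * ((4 / (ΛH * q)) * (π ^ 4 / (4 * 4 ^ N * ((4 / (ΛH * q)) * m * p) ^ 2)))
      / (2 * θ)))) ^ v) * ((Δ : ℝ) + 1) ^ 2 ≤ 1 / 2) (C : Finset V) :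
    pertZ (multivariateGaussian 0 ((4 / (ΛH * q)) • frdPiece ((4 / (ΛH * q)) • Mz) N)) g C ≠ 0 :=
  regulated_pertZ_ne_zero (scale_posSemidef P hHsym Mz hMz (by positivity) N)
    (scale_opBound P hHsym hfl hm hceil hΛH hP hp hPceil hq Mz hMz N) (scale_diag_le P hHsym hfl hm hceil hΛH hP hp hPceil hq Mz hMz N)
    (scale_const_nonneg hm hΛH hp hq N) (scale_hasFiniteRange P htri hsym hd0 hHloc hPloc Mz hMz _ N) cell hdisj hv hRsymm hR hΔ
    hnbr hε hκ hθ0 hθ1 hκθ hmeas hreg hsmall C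

/-- **THE END — `log Z` AT SCALE `N` IS EXTENSIVE, UNIFORMLY IN THE VOLUME**: for (273)'s data, disjoint chart cells of `≤ v` indices, a
symmetric adjacency with `≤ Δ` neighbours, regulated factors with `κK_N ≤ θ < 1`, and `e·εA_N^v·(Δ+1)² ≤ 1∕2`:
`‖log Z(C)‖ ≤ #C·(Δ+1)·2e·εA_N^v` under `N(0, c·C_N(cM_z))`, `A_N = (1−θ)^{−κK_N∕(2θ)}`. [folklore] -/
theorem scale_regulated_norm_pertLogZ_le [DecidableEq V] (hHsym : ∀ h k : ι → ℝ, H h k = H k h)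
    (hfl : ∀ h : ι → ℝ, m * ∑ x, h x ^ 2 ≤ H h h) (hm : 0 < m) (hceil : ∀ h : ι → ℝ, H h h ≤ ΛH * ∑ x, h x ^ 2) (hΛH : 0 < ΛH)
    (hP : ∀ z : σ → ℝ, p * ∑ i, z i ^ 2 ≤ ∑ x, P z x ^ 2) (hp : 0 < p) (hPceil : ∀ z : σ → ℝ, ∑ x, P z x ^ 2 ≤ q * ∑ i, z i ^ 2)
    (hq : 0 < q) (Mz : Matrix σ σ ℝ) (hMz : ∀ j k, Mz j k = H (P (Pi.single j 1)) (P (Pi.single k 1))) (N : ℕ)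
    (cell : V → Finset σ) (hdisj : ∀ p' q', p' ≠ q' → Disjoint (cell p') (cell q')) {v : ℕ} (hv : ∀ p', (cell p').card ≤ v)
    {R : V → V → Prop} [DecidableRel R] (hRsymm : ∀ x y, R x y → R y x) {nbr : V → Finset V} {Δ : ℕ} (hΔ : ∀ x, (nbr x).card ≤ Δ)
    (hnbr : ∀ x y, R x y → y ∈ nbr x) {g : V → EuclideanSpace ℝ σ → ℂ} {ε κ θ : ℝ} (hε : 0 ≤ ε) (hκ : 0 ≤ κ) (hθ0 : 0 < θ)
    (hθ1 : θ < 1) (hκθ : κ * ((4 / (ΛH * q)) * (π ^ 4 / (4 * 4 ^ N * ((4 / (ΛH * q)) * m * p) ^ 2))) ≤ θ)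
    (hreg : ∀ p' ω, ‖g p' ω‖ ≤ ε * exp (κ * (∑ j ∈ cell p', ω j ^ 2) / 2))
    (hsmall : Real.exp 1 * (ε * ((1 - θ) ^ (-(κ * ((4 / (ΛH * q)) * (π ^ 4 / (4 * 4 ^ N * ((4 / (ΛH * q)) * m * p) ^ 2)))
      / (2 * θ)))) ^ v) * ((Δ : ℝ) + 1) ^ 2 ≤ 1 / 2) (C : Finset V) :
    ‖pertLogZ (multivariateGaussian 0 ((4 / (ΛH * q)) • frdPiece ((4 / (ΛH * q)) • Mz) N)) g R C‖ ≤
      C.card * ((Δ : ℝ) + 1) * (2 * (Real.exp 1 * (ε * ((1 - θ) ^ (-(κ * ((4 / (ΛH * q)) *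
        (π ^ 4 / (4 * 4 ^ N * ((4 / (ΛH * q)) * m * p) ^ 2))) / (2 * θ)))) ^ v))) :=
  regulated_norm_pertLogZ_le (scale_posSemidef P hHsym Mz hMz (by positivity) N)
    (scale_opBound P hHsym hfl hm hceil hΛH hP hp hPceil hq Mz hMz N) (scale_diag_le P hHsym hfl hm hceil hΛH hP hp hPceil hq Mz hMz N)
    (scale_const_nonneg hm hΛH hp hq N) cell hdisj hv hRsymm hΔ hnbr hε hκ hθ0 hθ1 hκθ hreg hsmall C

/-! ## §3. Toy -/

/-- Toy (§1's constant): `K_N ≥ 0` at scale `N = 3` for unit data. -/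
example : (0 : ℝ) ≤ (4 / ((1 : ℝ) * 1)) * (π ^ 4 / (4 * 4 ^ 3 * ((4 / ((1 : ℝ) * 1)) * 1 * 1) ^ 2)) :=
  scale_const_nonneg (m := 1) (ΛH := 1) (p := 1) (q := 1) one_pos one_pos one_pos one_pos 3

end Summit.QuantumFields.BalabanUV.T4Continuum.NE7b.SupFibreScaleRegulatedGas
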